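import Summits.CriticalPhenomena.CardyFormulaZ2.Theses.CardyWhiteToColoured

/-!
# `NoiseFlowFromParts` for route CardyWhiteToColoured (item stmt-CriticalPhenomena-14140)

Pure bookkeeping: `DriftBound` compares the bond-ℤ² crossing probability `P_δ(R)` with the sign
percolation `P^latt_(ℓ,δ)(R)` of lattice white noise smoothed at width `ℓ`, and
`NoiseDiscretisation` compares the same lattice term with the continuum quantity `P^cont_ℓ(R)`,
both in the `lim_(ℓ→0) limsup_(δ→0⁺)` form.  Since the inline lattice terms of the two hypotheses
are syntactically identical, the triangle inequality (with `ε / 2` in each hypothesis, the smaller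
`ℓ₀` and, for each `ℓ`, the smaller `δ₀`) gives `NoiseFlowComparison`.
-/

namespace Summit.CriticalPhenomena.CardyFormulaZ2.Theorems

open Summit.CriticalPhenomena.CardyFormulaZ2.Theses.CardyWhiteToColoured

/-- Triangle inequality in the form used by the glue: two `ε / 2`-comparisons through a common
middle term give an `ε`-comparison. -/
theorem noiseFlowFromParts_abs_sub_lt {a b c ε : ℝ} (h1 : |a - b| < ε / 2)
    (h2 : |b - c| < ε / 2) : |a - c| < ε := by
  calc |a - c| ≤ |a - b| + |b - c| := abs_sub_le a b c
    _ < ε := by linarith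

/-- **`NoiseFlowFromParts`** (item stmt-CriticalPhenomena-14140 of route CardyWhiteToColoured):
`DriftBound → NoiseDiscretisation → NoiseFlowComparison`.  For `ε > 0` apply both hypotheses
with `ε / 2`, take `ℓ₀ = min` of the two `ℓ₀`'s and, for each `ℓ < ℓ₀`, `δ₀ = min` of the two
`δ₀`'s; conclude by the triangle inequality through the common lattice term. -/
theorem noiseFlowFromParts_proof :
    Summit.CriticalPhenomena.CardyFormulaZ2.Theses.CardyWhiteToColoured.NoiseFlowFromParts := by
  unfold NoiseFlowFromParts
  intro hD hN
  unfold NoiseFlowComparison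
  intro μ hμ hgen k hk R ε hε
  unfold DriftBound at hD
  unfold NoiseDiscretisation at hN
  obtain ⟨ℓ₁, hℓ₁, H₁⟩ := hD R (ε / 2) (half_pos hε)
  obtain ⟨ℓ₂, hℓ₂, H₂⟩ := hN μ hμ hgen k hk R (ε / 2) (half_pos hε)
  refine ⟨min ℓ₁ ℓ₂, lt_min hℓ₁ hℓ₂, fun ℓ hℓ hℓlt => ?_⟩
  obtain ⟨δ₁, hδ₁, K₁⟩ := H₁ ℓ hℓ (lt_of_lt_of_le hℓlt (min_le_left _ _))
  obtain ⟨δ₂, hδ₂, K₂⟩ := H₂ ℓ hℓ (lt_of_lt_of_le hℓlt (min_le_right _ _))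
  refine ⟨min δ₁ δ₂, lt_min hδ₁ hδ₂, fun δ hδ hδlt => ?_⟩
  exact noiseFlowFromParts_abs_sub_lt (K₁ δ hδ (lt_of_lt_of_le hδlt (min_le_left _ _)))
    (K₂ δ hδ (lt_of_lt_of_le hδlt (min_le_right _ _)))

end Summit.CriticalPhenomena.CardyFormulaZ2.Theorems
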